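import Summits.ResolutionOfSingularities.ResolutionOfSingularities.Theorems.FrobeniusClosingSteerInsepStepDegreeTwo
import Summits.ResolutionOfSingularities.ResolutionOfSingularities.Theorems.FrobeniusClosingSteerInsepStepDegreeFour
import Summits.ResolutionOfSingularities.ResolutionOfSingularities.Theorems.FrobeniusClosingSteerCleaningExact
import Summits.ResolutionOfSingularities.ResolutionOfSingularities.Theorems.FrobeniusClosingSteerPersistentArcCore
import Summits.ResolutionOfSingularities.ResolutionOfSingularities.Theorems.FrobeniusClosingSteerWords06SteeredVocab
import Literature.AlgebraicGeometry.Resolution.ExcellentRings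
import HarnessLib

/-!
# Steer / LEMMA I kernel, file F7: **`InsepStepNotIsolated d` HOLDS** — an exponent-one residually inseparable point step at constant cleaned order
# `d ≥ 4` (dimension 3, characteristic 2) makes the new radicand NON-isolated

OURS (campaign res-hironaka, rung L ★L-G4, slot W4.1, crux `Steer` stmt-ResolutionOfSingularities-16345; res-L0-w41-plan-1 RULINGS 149b (ii) / 155a:
kernel of res-L0-w41-idea-3's LEMMA I, signature `LemmaISketch.lean` 7682a092c1cb2d4d `def InsepStepNotIsolated (d : ℕ)` — the statement of
`insepStepNotIsolated_holds` below is its BODY VERBATIM; res-L0-w41-tri-1 TRIAGE v6.17 row R-LI PASSED the first step; res-L0-w41-stub-3 g7, blueprint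
`KERNEL-BLUEPRINT-LemmaI.md` 693d33707585fe97; replaces the role of no printed item; NOT a statement of the manuscript under review [claim: Hironaka2017,
status: under-review]; AI review is weaker than expert review). Theses-free, definition-free. COMPLETION-FREE: no Cohen structure, no coefficient field,
no Hasse–Taylor move; excellence is not used.

Assembly: the chart `X` of the quadratic transform and a minimal system `𝔪₀ = (X, Y, Z)` (`…InsepStepChart`); `x₀ = u·X` with `u ∈ S₁ˣ`, so the weak
transform `F₁ := u^d f₁` has `F₁ X^d = f₀ − g₀²`, the same cleaned order, and `f₀ − g₀² ∈ 𝔪₀^d` (`CleaningOptimal.mem_pow_of_quadraticTransform`);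
the 𝔪₀-adapted dual 2-basis frame of the geometric chart (`exists_frame_of_chart`); the residue configuration of the near point from `hinsep`/`hgrow`:
(A) rational — impossible (`false_of_rational_of_growth`); (B)/(B') degree two — `exists_sub_sq_mem_sq_of_degTwo` after the adapted change of the third
parameter; (C) degree four — `exists_sub_sq_mem_sq_of_degFour`; and the close by res-L0-w41-stub-1's (CD0)
`PersistentArc.not_hasIsolatedSingularity_of_sub_pow_mem_sq_span'` with `#{X, z'} = 2 < 3` resp. `#{X} = 1 < 3` generators.
[cite: Matsumura1987, Thm. 14.2, Thm. 17.10, Thm. 30.6] [cite: Cutkosky2014, §2.1] [folklore]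

SCOPE LINE (res-L0-w41-plan-1 RULING 160d / 186a, the «I″ separable-coverage sentence»): this completion-free frame argument covers EXACTLY the
residually INSEPARABLE exponent-one steps (it uses `∂_t (t² − ℓ) ∈ (X)` in characteristic `2`, i.e. that `∂_t` is logarithmic on `𝔪₁`, and the
«counts double» polynomial lemma for the square minimal polynomial); at a SEPARABLE non-rational near point `∂_t μ(t)` is a unit, the `T`-parity reading
is unavailable and `μ` has simple roots, so LEMMA I″ `NonRationalStepNotIsolated`'s separable part is NOT proved here (its route of record is tri-1 v6.18
(a)–(f) with CLAIM R and K3).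
-/

noncomputable section

-- single-problem summit: the doubled namespace component `ResolutionOfSingularities` is forced
set_option linter.dupNamespace false

namespace Summit.ResolutionOfSingularities.ResolutionOfSingularities.Theorems.SwitchingDichotomy.LemmaI

open IsLocalRing Literature.AlgebraicGeometry.Resolution
open Summit.ResolutionOfSingularities.ResolutionOfSingularities.Theorems.SwitchingDichotomy
open Summit.ResolutionOfSingularities.ResolutionOfSingularities.Theorems.SwitchingDichotomy.Words

variable {L : Type} [Field L] {S₀ S₁ : Subring L}

/-! ## §1 The close (CD0) from `F₁ − ψ² ∈ I²` -/

/-- From `F₁ − ψ² ∈ I²` with `F₁ = u^d f₁`, `u w = 1`, `d = 2m`: `f₁ − (w^m ψ)² ∈ I²`. [folklore] -/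
theorem sub_sq_mem_of_unit {I : Ideal S₁} {f₁ F₁ ψ u w : S₁} {m : ℕ} (huw : u * w = 1) (hF₁ : F₁ = f₁ * u ^ (2 * m))
    (hψ : F₁ - ψ ^ 2 ∈ I ^ 2) : f₁ - (w ^ m * ψ) ^ 2 ∈ I ^ 2 := by
  have : f₁ - (w ^ m * ψ) ^ 2 = w ^ (2 * m) * (F₁ - ψ ^ 2) := by
    have h1 : f₁ = F₁ * w ^ (2 * m) := by rw [hF₁, mul_assoc, ← mul_pow, huw, one_pow, mul_one]
    rw [h1]; ring
  rw [this]
  exact Ideal.mul_mem_left _ _ hψ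

/-- **(CD0) with two generators**: `f₁ − ψ² ∈ (X, z')²`, `X, z' ∈ 𝔪₁`, `dim S₁ = 3` ⇒ the radicand of `f₁` is not isolated. [cite: Matsumura1987, Thm. 14.2] -/
theorem not_isolated_of_sub_sq_mem_sq_pair [CharP L 2] (hreg₁ : IsRegularLocalRing S₁) (hdim₁ : ringKrullDim S₁ = 3) {f₁ ψ a b : S₁}
    (ha : a ∈ maximalIdeal S₁) (hb : b ∈ maximalIdeal S₁) (h : f₁ - ψ ^ 2 ∈ Ideal.span {a, b} ^ 2) :
    ¬ HasIsolatedSingularity (RadicandRing S₁ 2 f₁) := by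
  classical
  haveI := hreg₁
  refine PersistentArc.not_hasIsolatedSingularity_of_sub_pow_mem_sq_span' 2 f₁ ψ {a, b} (fun t ht => ?_) (by simpa using h)
    (lt_of_le_of_lt Finset.card_le_two (by norm_num)) hdim₁
  simp only [Finset.mem_insert, Finset.mem_singleton] at ht
  rcases ht with rfl | rfl
  · exact ha
  · exact hb

/-- **(CD0) with one generator**: `f₁ − ψ² ∈ (X)²`, `X ∈ 𝔪₁`, `dim S₁ = 3` ⇒ the radicand of `f₁` is not isolated. [cite: Matsumura1987, Thm. 14.2] -/
theorem not_isolated_of_sub_sq_mem_sq_single [CharP L 2] (hreg₁ : IsRegularLocalRing S₁) (hdim₁ : ringKrullDim S₁ = 3) {f₁ ψ a : S₁}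
    (ha : a ∈ maximalIdeal S₁) (h : f₁ - ψ ^ 2 ∈ Ideal.span {a} ^ 2) : ¬ HasIsolatedSingularity (RadicandRing S₁ 2 f₁) := by
  classical
  haveI := hreg₁
  refine PersistentArc.not_hasIsolatedSingularity_of_sub_pow_mem_sq_span' 2 f₁ ψ {a} (fun t ht => ?_) (by simpa using h)
    (by simp) hdim₁
  simp only [Finset.mem_singleton] at ht
  rw [ht]; exact ha

/-! ## §2 The theorem -/

/-- **LEMMA I (`InsepStepNotIsolated d` holds).** The statement is the body of res-L0-w41-idea-3's `def InsepStepNotIsolated (d : ℕ)` (`LemmaISketch.lean`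
7682a092c1cb2d4d) VERBATIM, so `LemmaI.InsepStepNotIsolated d` is closed by `insepStepNotIsolated_holds d` by `δ`-reduction. See the module docstring
for the proof. OURS; replaces the role of no printed item; NOT a statement of the manuscript under review. [cite: Matsumura1987, Thm. 14.2, Thm. 17.10,
Thm. 30.6] [cite: Cutkosky2014, §2.1] [folklore] -/
theorem insepStepNotIsolated_holds (d : ℕ) :
    ∀ (k L : Type) [Field k] [PerfectField k] [Field L] [CharP L 2] [Algebra k L]
    (S₀ S₁ : Subring L) [IsLocalRing S₀] [IsLocalRing S₁] (h₀₁ : S₀ ≤ S₁)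
    (f₀ g₀ : S₀) (f₁ : S₁) (x₀ : S₁),
    (∃ (A : Subalgebra k L) (Q : Ideal A), A.FG ∧ Q.IsPrime ∧
      ∀ z : L, z ∈ S₀ ↔ ∃ a b : A, b ∉ Q ∧ z = (a : L) / (b : L)) →
    IsRegularLocalRing S₀ → IsRegularLocalRing S₁ → IsExcellentRing S₀ → IsExcellentRing S₁ →
    ringKrullDim S₀ = 3 → ringKrullDim S₁ = 3 →
    IsQuadraticTransform S₀ S₁ →
    Ideal.span ((fun y : S₀ => (⟨(y : L), h₀₁ y.2⟩ : S₁)) '' (maximalIdeal S₀ : Set S₀)) = Ideal.span {x₀} →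
    Even d → 4 ≤ d →
    ((f₁ : S₁) : L) * ((x₀ : S₁) : L) ^ d = ((f₀ : S₀) : L) - ((g₀ : S₀) : L) ^ 2 →
    (∃ g₁ : S₁, f₁ - g₁ ^ 2 ∈ maximalIdeal S₁ ^ d) →
    (∀ u : S₁, ∃ v : S₀, u ^ 2 - ⟨(v : L), h₀₁ v.2⟩ ∈ maximalIdeal S₁) →
    (∃ u : S₁, ∀ v : S₀, u - ⟨(v : L), h₀₁ v.2⟩ ∉ maximalIdeal S₁) →
    ¬ HasIsolatedSingularity (RadicandRing S₁ 2 f₁) := by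
  intro k L _ _ _ _ _ S₀ S₁ _ _ h₀₁ f₀ g₀ f₁ x₀ hchart hreg₀ hreg₁ _ _ hdim₀ hdim₁ hQT hspan hdev hd4 hlaw hord hinsep hgrow
  classical
  haveI := hreg₀
  haveI := hreg₁
  set ι := Subring.inclusion h₀₁ with hι
  have hincl : ∀ v : S₀, (⟨(v : L), h₀₁ v.2⟩ : S₁) = ι v := fun v => rfl
  have hdom : SubringDominates S₀ S₁ := hQT.dominates
  -- ### the chart `X`
  have hQT' := hQT
  obtain ⟨_, X, hXm, hX0, _, hB, hfrac, _⟩ := hQT'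
  have hX0L : (X : L) ≠ 0 := fun e => hX0 (ZeroMemClass.coe_eq_zero.mp e)
  have hιL : ∀ v : S₀, ((ι v : S₁) : L) = (v : L) := fun v => rfl
  have h3₀ : (maximalIdeal S₀).spanFinrank = 3 := spanFinrank_eq_three hdim₀
  have hX2₀ : X ∉ maximalIdeal S₀ ^ 2 := IsQuadraticTransform.chart_not_mem_sq hB hdom hX0
  obtain ⟨Y₀, Z₀, hXYZ₀⟩ := exists_span_triple_eq_maximalIdeal h3₀ hXm hX2₀
  obtain ⟨-, hY₀m, hZ₀m⟩ := mem_of_span_triple_eq hXYZ₀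
  set t₀ : S₁ := ⟨(Y₀ : L) / X, div_mem_of_mem_maximalIdeal hB hY₀m⟩ with ht₀
  set z₀ : S₁ := ⟨(Z₀ : L) / X, div_mem_of_mem_maximalIdeal hB hZ₀m⟩ with hz₀
  have ht₀L : (t₀ : L) = Y₀ / X := rfl
  have hz₀L : (z₀ : L) = Z₀ / X := rfl
  have hXm₁ : ι X ∈ maximalIdeal S₁ := (inclusion_mem_maximalIdeal_iff hdom X).mpr hXm
  -- ### `x₀ = u · X` with `u` a unit; the weak transform `F₁ = u^d f₁`
  have hmap : (maximalIdeal S₀).map ι = Ideal.span {x₀} := hspan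
  have hx₀mem : x₀ ∈ Ideal.span {ι X} := by
    refine map_maximalIdeal_le_span_exc h₀₁ hB hX0L ?_
    rw [hmap]; exact Ideal.mem_span_singleton_self x₀
  have hXmem : ι X ∈ Ideal.span {x₀} := by rw [← hmap]; exact Ideal.mem_map_of_mem ι hXm
  obtain ⟨u, hu⟩ := Ideal.mem_span_singleton'.mp hx₀mem
  obtain ⟨w, hw⟩ := Ideal.mem_span_singleton'.mp hXmem
  have hX1 : ι X ≠ 0 := (map_ne_zero_iff ι (Subring.inclusion_injective h₀₁)).mpr hX0
  have huw : u * w = 1 := by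
    have : w * u * ι X = 1 * ι X := by rw [one_mul, mul_assoc, hu, hw]
    rw [mul_comm]
    exact mul_right_cancel₀ hX1 this
  obtain ⟨m, rfl⟩ : ∃ m, d = 2 * m := by obtain ⟨m, hm⟩ := hdev; exact ⟨m, by omega⟩
  set F₁ : S₁ := f₁ * u ^ (2 * m) with hF₁def
  have hF₁ : F₁ * ι X ^ (2 * m) = ι (f₀ - g₀ ^ 2) := by
    have : F₁ * ι X ^ (2 * m) = f₁ * x₀ ^ (2 * m) := by rw [hF₁def, mul_assoc, ← mul_pow, hu]
    rw [this]
    apply Subtype.ext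
    rw [map_sub, map_pow, Subring.coe_mul, Subring.coe_pow, AddSubgroupClass.coe_sub, Subring.coe_pow, hιL, hιL]
    exact hlaw
  have hordF : ∃ G₁ : S₁, F₁ - G₁ ^ 2 ∈ maximalIdeal S₁ ^ (2 * m) := by
    obtain ⟨g₁, hg₁⟩ := hord
    refine ⟨g₁ * u ^ m, ?_⟩
    have : F₁ - (g₁ * u ^ m) ^ 2 = u ^ (2 * m) * (f₁ - g₁ ^ 2) := by rw [hF₁def]; ring
    rw [this]
    exact Ideal.mul_mem_left _ _ hg₁
  have hf : f₀ - g₀ ^ 2 ∈ maximalIdeal S₀ ^ (2 * m) :=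
    CleaningOptimal.mem_pow_of_quadraticTransform hreg₀ hQT h₀₁ x₀ hspan (a := f₁) (by push_cast; rw [← hlaw, mul_comm])
  have hgrow' : ∃ uu : S₁, ∀ v : S₀, uu - ι v ∉ maximalIdeal S₁ := hgrow
  -- ### frames and closes for an adapted system `(X, Y, Z)`
  have degTwo : ∀ (Y Z : S₀), Ideal.span {X, Y, Z} = maximalIdeal S₀ → ∀ (t₁ z₁ : S₁), (t₁ : L) = Y / X → (z₁ : L) = Z / X →
      z₁ ∈ maximalIdeal S₁ → (∀ a : S₀, t₁ - ι a ∉ maximalIdeal S₁) → ¬ HasIsolatedSingularity (RadicandRing S₁ 2 f₁) := by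
    intro Y Z hXYZ t₁ z₁ ht₁ hz₁ hz₁m ht
    obtain ⟨ℓ, hℓ⟩ := hinsep t₁
    obtain ⟨e, uu, δ, dx, du, hgen, hδu, hδker, hdx, -, hdux, hduu⟩ :=
      exists_frame_of_chart S₀ hreg₀ hchart ![X, Y, Z] h3₀ (by rw [span_range_vec3]; exact hXYZ)
    obtain ⟨ψ, hψ⟩ := exists_sub_sq_mem_sq_of_degTwo hreg₀ hreg₁ hdim₁ hQT h₀₁ hXYZ hX0L hB hfrac t₁ z₁ ht₁ hz₁ hz₁m ht ℓ hℓ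
      uu δ dx du hgen hδu hδker hdx hdux hduu (by omega) hf hF₁ hordF
    exact not_isolated_of_sub_sq_mem_sq_pair hreg₁ hdim₁ hXm₁ hz₁m (sub_sq_mem_of_unit huw hF₁def hψ)
  have degFour : ∀ (Y Z : S₀), Ideal.span {X, Y, Z} = maximalIdeal S₀ → ∀ (t₁ z₁ : S₁), (t₁ : L) = Y / X → (z₁ : L) = Z / X →
      (∀ a : S₀, t₁ - ι a ∉ maximalIdeal S₁) → (∀ c e : S₀, z₁ - ι c - ι e * t₁ ∉ maximalIdeal S₁) →
      ¬ HasIsolatedSingularity (RadicandRing S₁ 2 f₁) := by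
    intro Y Z hXYZ t₁ z₁ ht₁ hz₁ ht hz
    obtain ⟨ℓ₁, hℓ₁⟩ := hinsep t₁
    obtain ⟨ℓ₂, hℓ₂⟩ := hinsep z₁
    obtain ⟨e, uu, δ, dx, du, hgen, hδu, hδker, hdx, -, hdux, hduu⟩ :=
      exists_frame_of_chart S₀ hreg₀ hchart ![X, Y, Z] h3₀ (by rw [span_range_vec3]; exact hXYZ)
    obtain ⟨ψ, hψ⟩ := exists_sub_sq_mem_sq_of_degFour hreg₀ hreg₁ hdim₁ hQT h₀₁ hXYZ hX0L hB hfrac t₁ z₁ ht₁ hz₁ ht hz ℓ₁ ℓ₂ hℓ₁ hℓ₂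
      uu δ dx du hgen hδu hδker hdx hdux hduu (by omega) hf hF₁ hordF
    exact not_isolated_of_sub_sq_mem_sq_single hreg₁ hdim₁ hXm₁ (sub_sq_mem_of_unit huw hF₁def hψ)
  -- ### the residue configuration of the near point
  by_cases hAt : ∃ a : S₀, t₀ - ι a ∈ maximalIdeal S₁
  · by_cases hAz : ∃ b : S₀, z₀ - ι b ∈ maximalIdeal S₁
    · -- (A) rational near point: impossible
      exfalso
      obtain ⟨a, ha⟩ := hAt
      obtain ⟨b, hb⟩ := hAz
      exact false_of_rational_of_growth hQT h₀₁ hXYZ₀ hX0L hB hfrac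
        ⟨a, t₀ - ι a, ha, by rw [AddSubgroupClass.coe_sub, ht₀L, hιL]; ring⟩
        ⟨b, z₀ - ι b, hb, by rw [AddSubgroupClass.coe_sub, hz₀L, hιL]; ring⟩ hgrow'
    · -- (B') `z̄'` irrational, `t̄` rational: swap the roles of `Y` and `Z`, adapted third parameter `Y₀ − aX`
      obtain ⟨a, ha⟩ := hAt
      have hz : ∀ b : S₀, z₀ - ι b ∉ maximalIdeal S₁ := fun b hb => hAz ⟨b, hb⟩
      have hXYZ : Ideal.span {X, Z₀, Y₀ - a * X - 0 * Z₀} = maximalIdeal S₀ := by rw [span_triple_sub_eq, span_triple_swap]; exact hXYZ₀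
      refine degTwo Z₀ (Y₀ - a * X - 0 * Z₀) hXYZ z₀ (t₀ - ι a) hz₀L ?_ ha hz
      rw [AddSubgroupClass.coe_sub, ht₀L, hιL]
      push_cast
      field_simp
      ring
  · have ht : ∀ a : S₀, t₀ - ι a ∉ maximalIdeal S₁ := fun a ha => hAt ⟨a, ha⟩
    by_cases hBz : ∃ c e : S₀, z₀ - ι c - ι e * t₀ ∈ maximalIdeal S₁
    · -- (B) degree two, adapted third parameter `Z₀ − cX − eY₀`
      obtain ⟨c, e, hce⟩ := hBz
      have hXYZ : Ideal.span {X, Y₀, Z₀ - c * X - e * Y₀} = maximalIdeal S₀ := by rw [span_triple_sub_eq]; exact hXYZ₀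
      refine degTwo Y₀ (Z₀ - c * X - e * Y₀) hXYZ t₀ (z₀ - ι c - ι e * t₀) ht₀L ?_ hce ht
      rw [AddSubgroupClass.coe_sub, AddSubgroupClass.coe_sub, Subring.coe_mul, hz₀L, ht₀L, hιL, hιL]
      push_cast
      field_simp
    · -- (C) degree four
      have hz : ∀ c e : S₀, z₀ - ι c - ι e * t₀ ∉ maximalIdeal S₁ := fun c e hce => hBz ⟨c, e, hce⟩
      exact degFour Y₀ Z₀ hXYZ₀ t₀ z₀ ht₀L hz₀L ht hz

end Summit.ResolutionOfSingularities.ResolutionOfSingularities.Theorems.SwitchingDichotomy.LemmaI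

end
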